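import Summits.RiemannHypothesis.RiemannHypothesis.Theorems.PfPersistenceM2EvenSectorIndexExact
import HarnessLib

/-!
# PF-persistence, cand-7 seat (pub-rhpf, gen 5), two-parity index ladder, part 1/3: the ODD negative index is
# `≤ K` and the FULL REAL negative index is `≤ 2K`

pub-rhpf cell, candidate seat 7 (floating B), generation 5.  HONEST FRAMING (page 1 of everything in this
cell): a long-odds MECHANISM / RIGIDITY SEARCH around Weil's quadratic functional; NOTHING here claims,
approaches or conditionally proves RH.  Labels: PROVED = kernel-checked (this file, RH-free throughout);
CITED = in print (E. Bombieri, *Remarks on Weil's quadratic functional in the theory of prime numbers I*,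
Rend. Mat. Acc. Lincei (9) 11 (2000), Thm 8: the full form has one negative eigenvalue per off-line zero `γ` with
`Im γ > 0`, i.e. `2K` for `ζ`; Thm 9: `K` in EACH parity sector [Bombieri2000Weil]; H. Yoshida, Invent. Math. 110
(1992), Prop. 1 [Yoshida1992HermitianForms]); HYPOTHESIS = an explicit binder.

Notation: `Q = weilQuadratic` (untruncated), `ĝ = weilMellin g`, `𝒬 = {ρ : ζ(ρ) = 0 non-trivial, Re ρ > 1/2,
Im ρ > 0}` (quadrant representatives of off-line quadruples), `K = #𝒬`.  The M2 seat's packet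
(`PfPersistenceM2EvenSectorIndexBound/Lower/Exact`, `PfPersistenceM2RealSectorSecondLevel`) proved: EVEN negative
index on long windows `= K` (for `K < ∞`), the second EVEN level `⟺ K ≤ 1`, and levels 1 and 2 of the FULL REAL
form are RH-equivalent.  Its named residue (HOME/M2-ROUTE.md §11): the ODD halves and the full-form levels `≥ 3` —
supplied by this seat's three-part packet `PfPersistenceTwoParityIndexBound` (odd `≤ K`, real `≤ 2K`),
`PfPersistenceTwoParityIndexFamilies` (index language, appending parity families, lower halves) and
`PfPersistenceTwoParityIndexLevels` (the level hierarchy of the full real form; third level `⟺ K ≤ 1`).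

PROVED in this part (all RH-free):
* §A (odd symmetries) for an ODD real `g`: `Re ĝ = 0` on the critical line
  (`re_weilMellin_eq_zero_of_re_eq_half_odd`: `conj ĝ(s) = ĝ(s̄) = ĝ(1-s) = -ĝ(s)` there); the quadruple
  `ρ, ρ̄, 1-ρ, 1-ρ̄` carries `x, x̄, -x, -x̄`, so ONE real condition `Re ĝ(ρ) = 0` per quadrant representative
  transports to every zero (`re_weilMellin_eq_zero_of_quadrant_odd`); and since `P_g(ρ) = -ĝ(ρ)²` (tree,
  `pairCoeff_of_odd_real`) every term of `Re Q(g) = Σ m(ρ)((Im ĝ)² - (Re ĝ)²)(ρ)` is then `≥ 0`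
  (`re_weilQuadratic_nonneg_of_re_zero_odd`).
* §B (`exists_combination_re_weilQuadratic_nonneg_odd`, `card_le_encard_quadrant_of_negative_odd_family`): an
  `n`-dimensional family of ODD real Weil tests on whose real span `Re Q` is negative definite forces
  `n ≤ 𝒬.encard` [CITED shape: Bombieri 2000 Thm 9, odd part `K_E^-`, there for truncations; here untruncated];
  the kernel forms `re_weilQuadratic_combination_nonneg_even/_odd` expose the inner step for both parities.
* §C (`exists_combination_re_weilQuadratic_nonneg_real`, `card_le_two_mul_encard_quadrant_of_negative_real_family`):
  a negative-definite family of REAL Weil tests (no parity) has dimension `≤ 2·𝒬.encard` — split each test into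
  even + odd part (`Q`-orthogonal sectors, tree `stub_evenOddDecomposition`) and impose the `2·#𝒬` conditions
  `Im Ĝ_ev = 0`, `Re Ĝ_odd = 0` on `𝒬` [CITED shape: Bombieri 2000 Thm 8].

What this part does NOT touch: `K = ∞` beyond the `ℕ∞` bookkeeping (compactly supported probes cannot dominate
the tail; in print Bombieri 2000, Cor. to Thm 11) and any lower bound on a FIRST level (Weil positivity =
RH-strength).
-/

noncomputable section

set_option linter.dupNamespace false

open Complex Filter Set MeasureTheory
open scoped Real Topology ComplexConjugate BigOperators

namespace Summit.RiemannHypothesis.RiemannHypothesis.Theorems.PfPersistenceParityIndex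

open Literature.NumberTheory.LFunctions
open Literature.NumberTheory.LFunctions.WeilConverse
open Literature.NumberTheory.LFunctions.ZetaZeros
open Summit.RiemannHypothesis.RiemannHypothesis.Theorems.RuelleBandExactFirstBand
  (weilMellin_one_sub_of_odd conj_weilMellin_of_real pairCoeff_of_odd_real stub_evenOddDecomposition
    stub_evenOddDecomposition_isWeilTest_neg stub_evenOddDecomposition_isWeilTest_half_add
    stub_evenOddDecomposition_isWeilTest_half_sub)
open Summit.RiemannHypothesis.RiemannHypothesis.Theorems.PfPersistenceM2NegIndex

-- `𝒬` = the open quadrant of non-trivial zeros, `Re ρ > 1/2`, `Im ρ > 0` (one representative per off-line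
-- quadruple); a NOTATION (not a definition), so every statement below is literally over the M2 seat's set.
set_option quotPrecheck false in
local notation "𝒬" => {ρ : ℂ | ρ ∈ riemannZetaNontrivialZeros ∧ 1 / 2 < ρ.re ∧ 0 < ρ.im}

/-! ## A. Odd real test functions: transform symmetries, one condition per quadruple, termwise positivity -/

/-- On the critical line the transform of an ODD real `g` is PURELY IMAGINARY: `Re s = 1/2 → Re ĝ(s) = 0`
(`conj ĝ(s) = ĝ(s̄) = ĝ(1 - s) = -ĝ(s)` there). [cite: Bombieri2000Weil, §7] -/
theorem re_weilMellin_eq_zero_of_re_eq_half_odd {g : ℝ → ℂ} (hodd : ∀ t : ℝ, g (-t) = -g t)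
    (hreal : ∀ t : ℝ, (g t).im = 0) {s : ℂ} (hs : s.re = 1 / 2) : (weilMellin g s).re = 0 := by
  have h1 : conj s = 1 - s := by
    apply Complex.ext
    · simp only [Complex.conj_re, Complex.sub_re, Complex.one_re, hs]; norm_num
    · simp only [Complex.conj_im, Complex.sub_im, Complex.one_im]; ring
  have h := conj_weilMellin_of_real hreal s
  rw [h1, weilMellin_one_sub_of_odd hodd] at h
  have h2 := congrArg Complex.re h
  simp only [Complex.conj_re, Complex.neg_re] at h2
  linarith

/-- **Symmetry transport, odd case.**  Let `g` be odd and real-valued and let `Z` contain every non-trivial zero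
of the open quadrant.  If `Re ĝ` vanishes on `Z` then `Re ĝ(ρ) = 0` at EVERY non-trivial zero: on the line by
`re_weilMellin_eq_zero_of_re_eq_half_odd`, off the line because `ĝ` takes the values `x, x̄, -x, -x̄` on
`ρ, ρ̄, 1 - ρ, 1 - ρ̄`. [cite: Bombieri2000Weil, Thm 9] -/
theorem re_weilMellin_eq_zero_of_quadrant_odd {g : ℝ → ℂ} (hodd : ∀ t : ℝ, g (-t) = -g t)
    (hreal : ∀ t : ℝ, (g t).im = 0) {Z : Set ℂ}
    (hZ : ∀ ρ ∈ riemannZetaNontrivialZeros, 1 / 2 < ρ.re → 0 < ρ.im → ρ ∈ Z)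
    (hvan : ∀ ρ ∈ Z, (weilMellin g ρ).re = 0) {ρ : ℂ} (hρ : ρ ∈ riemannZetaNontrivialZeros) :
    (weilMellin g ρ).re = 0 := by
  have him : ρ.im ≠ 0 := riemannZetaNontrivialZeros.im_ne_zero hρ
  rcases lt_trichotomy ρ.re (1 / 2) with hlt | heq | hgt
  · rcases lt_or_gt_of_ne him with hneg | hpos
    · -- `Re ρ < 1/2`, `Im ρ < 0`: the representative is `1 − ρ`, where `ĝ(1 − ρ) = -ĝ(ρ)`
      have hmem : 1 - ρ ∈ riemannZetaNontrivialZeros := by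
        simpa using riemannZetaNontrivialZeros.one_sub_conj_mem (riemannZetaNontrivialZeros.conj_mem hρ)
      have h1 := hvan _ (hZ _ hmem (by simp only [Complex.sub_re, Complex.one_re]; linarith)
        (by simp only [Complex.sub_im, Complex.one_im]; linarith))
      rw [weilMellin_one_sub_of_odd hodd, Complex.neg_re] at h1
      linarith
    · -- `Re ρ < 1/2`, `Im ρ > 0`: the representative is `1 − ρ̄`, where `ĝ(1 − ρ̄) = -conj ĝ(ρ)`
      have hmem := riemannZetaNontrivialZeros.one_sub_conj_mem hρ
      have h1 := hvan _ (hZ _ hmem (by simp only [Complex.sub_re, Complex.one_re, Complex.conj_re]; linarith)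
        (by simp only [Complex.sub_im, Complex.one_im, Complex.conj_im]; linarith))
      rw [weilMellin_one_sub_of_odd hodd, ← conj_weilMellin_of_real hreal, Complex.neg_re,
        Complex.conj_re] at h1
      linarith
  · exact re_weilMellin_eq_zero_of_re_eq_half_odd hodd hreal heq
  · rcases lt_or_gt_of_ne him with hneg | hpos
    · -- `Re ρ > 1/2`, `Im ρ < 0`: the representative is `ρ̄`, where `ĝ(ρ̄) = conj ĝ(ρ)`
      have hmem := riemannZetaNontrivialZeros.conj_mem hρ
      have h1 := hvan _ (hZ _ hmem (by simp only [Complex.conj_re]; linarith)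
        (by simp only [Complex.conj_im]; linarith))
      rwa [← conj_weilMellin_of_real hreal, Complex.conj_re] at h1
    · exact hvan _ (hZ _ hρ hgt hpos)

/-- **Termwise positivity, odd case.**  For an odd real Weil test `g` with `Re ĝ(ρ) = 0` at every non-trivial
zero, `Re Q(g) = Σ_ρ m(ρ) (Im ĝ(ρ))² ≥ 0` (`Q(g) = Σ m(ρ) P_g(ρ)` by the PROVED explicit formula, and
`P_g(ρ) = -ĝ(ρ)²` with `ĝ(ρ)` purely imaginary). [cite: Bombieri2000Weil, Thm 1] -/
theorem re_weilQuadratic_nonneg_of_re_zero_odd {g : ℝ → ℂ} (hg : IsWeilTest g)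
    (hodd : ∀ t : ℝ, g (-t) = -g t) (hreal : ∀ t : ℝ, (g t).im = 0)
    (hvan : ∀ ρ ∈ riemannZetaNontrivialZeros, (weilMellin g ρ).re = 0) :
    0 ≤ (weilQuadratic g).re := by
  have hQ : zeroForm g = weilQuadratic g :=
    tendsto_nhds_unique (hasWeilZeroSide_zeroForm hg) (explicit_formula_holds (hg.weilConv hg.weilReflect))
  rw [← hQ, zeroForm, Complex.re_tsum (summable_pairCoeff hg)]
  refine tsum_nonneg fun ρ ↦ ?_
  have hsq : pairCoeff g ρ = (((weilMellin g (ρ : ℂ)).im ^ 2 : ℝ) : ℂ) := by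
    rw [pairCoeff_of_odd_real hodd hreal]
    apply Complex.ext
    · rw [Complex.ofReal_re, Complex.neg_re, Complex.mul_re, hvan ρ ρ.2, sq]; ring
    · rw [Complex.ofReal_im, Complex.neg_im, Complex.mul_im, hvan ρ ρ.2]; ring
  have hm : (0 : ℝ) ≤ (riemannZetaZeroOrder (ρ : ℂ) : ℝ) := by
    have h0 : (0 : ℤ) ≤ riemannZetaZeroOrder (ρ : ℂ) :=
      le_trans zero_le_one (riemannZetaNontrivialZeros.one_le_order ρ.2)
    exact_mod_cast h0
  rw [hsq]
  simp only [Complex.mul_re, Complex.ofReal_re, Complex.ofReal_im, Complex.intCast_re, Complex.intCast_im,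
    mul_zero, sub_zero]
  exact mul_nonneg hm (sq_nonneg _)

/-! ## B. Real combinations; the odd negative index is at most `#𝒬` -/

/-- A real combination of Weil tests is a Weil test. [folklore] -/
theorem isWeilTest_combination {ι : Type*} [Fintype ι] (g : ι → ℝ → ℂ) (htest : ∀ i, IsWeilTest (g i))
    (c : ι → ℝ) : IsWeilTest (fun t : ℝ ↦ ∑ i, (c i : ℂ) * g i t) :=
  isWeilTest_finset_sum Finset.univ fun i _ ↦ (htest i).const_mul (c i)

/-- Its transform is the combination of the transforms. [folklore] -/
theorem weilMellin_combination {ι : Type*} [Fintype ι] (g : ι → ℝ → ℂ) (htest : ∀ i, IsWeilTest (g i))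
    (c : ι → ℝ) (s : ℂ) :
    weilMellin (fun t : ℝ ↦ ∑ i, (c i : ℂ) * g i t) s = ∑ i, (c i : ℂ) * weilMellin (g i) s := by
  have h := weilMellin_finset_sum Finset.univ (f := fun i (t : ℝ) ↦ (c i : ℂ) * g i t)
    (fun i _ ↦ (htest i).const_mul (c i)) s
  simpa only [weilMellin_const_mul] using h

/-- **Even sector, kernel form** (the inner step of the M2 seat's `exists_combination_re_weilQuadratic_nonneg`,
exposed): if `Σᵢ cᵢ Im ĝᵢ = 0` on a set `Z ⊇ 𝒬` for even real Weil tests `gᵢ`, then `Re Q(Σ cᵢ gᵢ) ≥ 0`.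
[cite: Bombieri2000Weil, Thm 9 (even part)] -/
theorem re_weilQuadratic_combination_nonneg_even {ι : Type*} [Fintype ι] {Z : Set ℂ}
    (hZ : ∀ ρ ∈ riemannZetaNontrivialZeros, 1 / 2 < ρ.re → 0 < ρ.im → ρ ∈ Z)
    (g : ι → ℝ → ℂ) (htest : ∀ i, IsWeilTest (g i)) (heven : ∀ i (t : ℝ), g i (-t) = g i t)
    (hreal : ∀ i (t : ℝ), (g i t).im = 0) (c : ι → ℝ)
    (hker : ∀ ρ ∈ Z, ∑ i, c i * (weilMellin (g i) ρ).im = 0) :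
    0 ≤ (weilQuadratic (fun t : ℝ ↦ ∑ i, (c i : ℂ) * g i t)).re := by
  have hGtest := isWeilTest_combination g htest c
  have hGeven : ∀ t : ℝ, (fun t : ℝ ↦ ∑ i, (c i : ℂ) * g i t) (-t) = (fun t : ℝ ↦ ∑ i, (c i : ℂ) * g i t) t :=
    fun t ↦ by simp only [heven]
  have hGreal : ∀ t : ℝ, ((fun t : ℝ ↦ ∑ i, (c i : ℂ) * g i t) t).im = 0 := fun t ↦ by
    simp [Complex.im_sum, Complex.mul_im, hreal]
  have hvanZ : ∀ ρ ∈ Z, (weilMellin (fun t : ℝ ↦ ∑ i, (c i : ℂ) * g i t) ρ).im = 0 := by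
    intro ρ hρ
    rw [weilMellin_combination g htest c, Complex.im_sum]
    simpa [Complex.mul_im] using hker ρ hρ
  have hvan : ∀ ρ ∈ riemannZetaNontrivialZeros, (weilMellin (fun t : ℝ ↦ ∑ i, (c i : ℂ) * g i t) ρ).im = 0 :=
    fun ρ hρ ↦ im_weilMellin_eq_zero_of_quadrant hGeven hGreal hZ hvanZ hρ
  exact re_weilQuadratic_nonneg_of_im_zero hGtest hGeven hGreal hvan

/-- **Odd sector, kernel form**: if `Σᵢ cᵢ Re ĝᵢ = 0` on a set `Z ⊇ 𝒬` for odd real Weil tests `gᵢ`, then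
`Re Q(Σ cᵢ gᵢ) ≥ 0`. [cite: Bombieri2000Weil, Thm 9 (odd part)] -/
theorem re_weilQuadratic_combination_nonneg_odd {ι : Type*} [Fintype ι] {Z : Set ℂ}
    (hZ : ∀ ρ ∈ riemannZetaNontrivialZeros, 1 / 2 < ρ.re → 0 < ρ.im → ρ ∈ Z)
    (g : ι → ℝ → ℂ) (htest : ∀ i, IsWeilTest (g i)) (hodd : ∀ i (t : ℝ), g i (-t) = -g i t)
    (hreal : ∀ i (t : ℝ), (g i t).im = 0) (c : ι → ℝ)
    (hker : ∀ ρ ∈ Z, ∑ i, c i * (weilMellin (g i) ρ).re = 0) :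
    0 ≤ (weilQuadratic (fun t : ℝ ↦ ∑ i, (c i : ℂ) * g i t)).re := by
  have hGtest := isWeilTest_combination g htest c
  have hGodd : ∀ t : ℝ, (fun t : ℝ ↦ ∑ i, (c i : ℂ) * g i t) (-t) = -(fun t : ℝ ↦ ∑ i, (c i : ℂ) * g i t) t :=
    fun t ↦ by simp only [hodd, mul_neg, Finset.sum_neg_distrib]
  have hGreal : ∀ t : ℝ, ((fun t : ℝ ↦ ∑ i, (c i : ℂ) * g i t) t).im = 0 := fun t ↦ by
    simp [Complex.im_sum, Complex.mul_im, hreal]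
  have hvanZ : ∀ ρ ∈ Z, (weilMellin (fun t : ℝ ↦ ∑ i, (c i : ℂ) * g i t) ρ).re = 0 := by
    intro ρ hρ
    rw [weilMellin_combination g htest c, Complex.re_sum]
    simpa [Complex.mul_re, hreal] using hker ρ hρ
  have hvan : ∀ ρ ∈ riemannZetaNontrivialZeros, (weilMellin (fun t : ℝ ↦ ∑ i, (c i : ℂ) * g i t) ρ).re = 0 :=
    fun ρ hρ ↦ re_weilMellin_eq_zero_of_quadrant_odd hGodd hGreal hZ hvanZ hρ
  exact re_weilQuadratic_nonneg_of_re_zero_odd hGtest hGodd hGreal hvan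

/-- **MAIN, odd sector (negative index of the odd real Weil form ≤ number of off-line quadruples).**  Let the
finset `Z` contain every non-trivial zero with `Re ρ > 1/2`, `Im ρ > 0`, and let `(gᵢ)_{i ∈ ι}` be ODD real Weil
tests with `#ι > #Z`.  Then some non-trivial real combination has `Re Q(Σ cᵢ gᵢ) ≥ 0`: the `ℝ`-linear map
`c ↦ (Σᵢ cᵢ Re ĝᵢ(ρ))_{ρ ∈ Z}` has a kernel by dimension count. RH-free. [cite: Bombieri2000Weil, Thm 9 (odd part)] -/
theorem exists_combination_re_weilQuadratic_nonneg_odd {ι : Type*} [Fintype ι] (Z : Finset ℂ)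
    (hZ : ∀ ρ ∈ riemannZetaNontrivialZeros, 1 / 2 < ρ.re → 0 < ρ.im → ρ ∈ Z)
    (hcard : Z.card < Fintype.card ι) (g : ι → ℝ → ℂ) (htest : ∀ i, IsWeilTest (g i))
    (hodd : ∀ i (t : ℝ), g i (-t) = -g i t) (hreal : ∀ i (t : ℝ), (g i t).im = 0) :
    ∃ c : ι → ℝ, c ≠ 0 ∧ 0 ≤ (weilQuadratic (fun t : ℝ ↦ ∑ i, (c i : ℂ) * g i t)).re := by
  classical
  let L : (ι → ℝ) →ₗ[ℝ] (Z → ℝ) :=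
    { toFun := fun c ρ ↦ ∑ i, c i * (weilMellin (g i) (ρ : ℂ)).re
      map_add' := by
        intro c d
        funext ρ
        simp only [Pi.add_apply, add_mul, Finset.sum_add_distrib]
      map_smul' := by
        intro r c
        funext ρ
        simp only [Pi.smul_apply, smul_eq_mul, RingHom.id_apply, Finset.mul_sum, mul_assoc] }
  have hker : LinearMap.ker L ≠ ⊥ :=
    LinearMap.ker_ne_bot_of_finrank_lt
      (by simpa [Module.finrank_fintype_fun_eq_card, Fintype.card_coe] using hcard)
  obtain ⟨c, hc, hc0⟩ := Submodule.exists_mem_ne_zero_of_ne_bot hker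
  have hZ' : ∀ ρ ∈ riemannZetaNontrivialZeros, 1 / 2 < ρ.re → 0 < ρ.im → ρ ∈ (Z : Set ℂ) :=
    fun ρ hρ h1 h2 ↦ by simpa using hZ ρ hρ h1 h2
  refine ⟨c, hc0, re_weilQuadratic_combination_nonneg_odd hZ' g htest hodd hreal c fun ρ hρ ↦ ?_⟩
  have hρ' : ρ ∈ Z := by simpa using hρ
  have h := congrFun (LinearMap.mem_ker.1 hc) ⟨ρ, hρ'⟩
  simpa [L] using h

/-- **Counted contrapositive, odd sector.**  An `#ι`-dimensional family of ODD real Weil tests on whose real span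
`Re Q` is negative definite forces at least `#ι` zeros of `ζ` in the open quadrant (as an `ℕ∞`-cardinality).
[cite: Bombieri2000Weil, Thm 9 (odd part)] -/
theorem card_le_encard_quadrant_of_negative_odd_family {ι : Type*} [Fintype ι] (g : ι → ℝ → ℂ)
    (htest : ∀ i, IsWeilTest (g i)) (hodd : ∀ i (t : ℝ), g i (-t) = -g i t)
    (hreal : ∀ i (t : ℝ), (g i t).im = 0)
    (hneg : ∀ c : ι → ℝ, c ≠ 0 → (weilQuadratic (fun t : ℝ ↦ ∑ i, (c i : ℂ) * g i t)).re < 0) :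
    (Fintype.card ι : ℕ∞) ≤ Set.encard 𝒬 := by
  by_contra hlt
  rw [not_le] at hlt
  have hfin : Set.Finite 𝒬 := Set.encard_lt_top_iff.1 (hlt.trans (ENat.coe_lt_top _))
  rw [hfin.encard_eq_coe_toFinset_card, Nat.cast_lt] at hlt
  obtain ⟨c, hc0, hQ⟩ := exists_combination_re_weilQuadratic_nonneg_odd hfin.toFinset
    (fun ρ hρ h1 h2 ↦ hfin.mem_toFinset.2 ⟨hρ, h1, h2⟩) hlt g htest hodd hreal
  exact absurd (hneg c hc0) (not_lt.2 hQ)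

/-! ## C. The full REAL form: negative index at most `2·#𝒬` -/

/-- **MAIN, full real form (negative index ≤ twice the number of off-line quadruples).**  Let the finset `Z`
contain every quadrant zero and let `(gᵢ)_{i ∈ ι}` be REAL Weil tests (no parity) with `#ι > 2·#Z`.  Then some
non-trivial real combination has `Re Q(Σ cᵢ gᵢ) ≥ 0`.  Proof: split `gᵢ = eᵢ + oᵢ` into even and odd parts; the
`2·#Z` real conditions `Σ cᵢ Im êᵢ(ρ) = 0`, `Σ cᵢ Re ôᵢ(ρ) = 0` (`ρ ∈ Z`) have a common non-trivial solution;
then `Re Q(Σ cᵢ gᵢ) = Re Q(Σ cᵢ eᵢ) + Re Q(Σ cᵢ oᵢ) ≥ 0` (sectors `Q`-orthogonal, tree `stub_evenOddDecomposition`;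
§B kernel forms). RH-free. [cite: Bombieri2000Weil, Thm 8] -/
theorem exists_combination_re_weilQuadratic_nonneg_real {ι : Type*} [Fintype ι] (Z : Finset ℂ)
    (hZ : ∀ ρ ∈ riemannZetaNontrivialZeros, 1 / 2 < ρ.re → 0 < ρ.im → ρ ∈ Z)
    (hcard : 2 * Z.card < Fintype.card ι) (g : ι → ℝ → ℂ) (htest : ∀ i, IsWeilTest (g i))
    (hreal : ∀ i (t : ℝ), (g i t).im = 0) :
    ∃ c : ι → ℝ, c ≠ 0 ∧ 0 ≤ (weilQuadratic (fun t : ℝ ↦ ∑ i, (c i : ℂ) * g i t)).re := by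
  classical
  -- even and odd parts of the tests
  set e : ι → ℝ → ℂ := fun i t ↦ (g i t + g i (-t)) / 2 with he_def
  set o : ι → ℝ → ℂ := fun i t ↦ (g i t - g i (-t)) / 2 with ho_def
  have hn : ∀ i, IsWeilTest fun t : ℝ ↦ g i (-t) := fun i ↦ stub_evenOddDecomposition_isWeilTest_neg (htest i)
  have hetest : ∀ i, IsWeilTest (e i) := fun i ↦
    stub_evenOddDecomposition_isWeilTest_half_add (htest i) (hn i)
  have hotest : ∀ i, IsWeilTest (o i) := fun i ↦
    stub_evenOddDecomposition_isWeilTest_half_sub (htest i) (hn i)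
  have heeven : ∀ i (t : ℝ), e i (-t) = e i t := fun i t ↦ by simp only [he_def, neg_neg]; ring
  have hoodd : ∀ i (t : ℝ), o i (-t) = -o i t := fun i t ↦ by simp only [ho_def, neg_neg]; ring
  have hereal : ∀ i (t : ℝ), (e i t).im = 0 := fun i t ↦ by simp [he_def, Complex.div_ofNat_im, hreal]
  have horeal : ∀ i (t : ℝ), (o i t).im = 0 := fun i t ↦ by simp [ho_def, Complex.div_ofNat_im, hreal]
  -- the `2·#Z` real-linear conditions
  let w : (Z ⊕ Z) → ι → ℝ :=
    Sum.elim (fun ρ i ↦ (weilMellin (e i) (ρ : ℂ)).im) (fun ρ i ↦ (weilMellin (o i) (ρ : ℂ)).re)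
  let L : (ι → ℝ) →ₗ[ℝ] ((Z ⊕ Z) → ℝ) :=
    { toFun := fun c x ↦ ∑ i, c i * w x i
      map_add' := by
        intro c d
        funext x
        simp only [Pi.add_apply, add_mul, Finset.sum_add_distrib]
      map_smul' := by
        intro r c
        funext x
        simp only [Pi.smul_apply, smul_eq_mul, RingHom.id_apply, Finset.mul_sum, mul_assoc] }
  have hker : LinearMap.ker L ≠ ⊥ :=
    LinearMap.ker_ne_bot_of_finrank_lt (by
      simp only [Module.finrank_fintype_fun_eq_card, Fintype.card_sum, Fintype.card_coe]
      omega)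
  obtain ⟨c, hc, hc0⟩ := Submodule.exists_mem_ne_zero_of_ne_bot hker
  refine ⟨c, hc0, ?_⟩
  have hZ' : ∀ ρ ∈ riemannZetaNontrivialZeros, 1 / 2 < ρ.re → 0 < ρ.im → ρ ∈ (Z : Set ℂ) :=
    fun ρ hρ h1 h2 ↦ by simpa using hZ ρ hρ h1 h2
  have hkerE : ∀ ρ ∈ (Z : Set ℂ), ∑ i, c i * (weilMellin (e i) ρ).im = 0 := by
    intro ρ hρ
    have hρ' : ρ ∈ Z := by simpa using hρ
    have h := congrFun (LinearMap.mem_ker.1 hc) (Sum.inl ⟨ρ, hρ'⟩)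
    simpa [L, w] using h
  have hkerO : ∀ ρ ∈ (Z : Set ℂ), ∑ i, c i * (weilMellin (o i) ρ).re = 0 := by
    intro ρ hρ
    have hρ' : ρ ∈ Z := by simpa using hρ
    have h := congrFun (LinearMap.mem_ker.1 hc) (Sum.inr ⟨ρ, hρ'⟩)
    simpa [L, w] using h
  have hE := re_weilQuadratic_combination_nonneg_even hZ' e hetest heeven hereal c hkerE
  have hO := re_weilQuadratic_combination_nonneg_odd hZ' o hotest hoodd horeal c hkerO
  -- `Q(G) = Q(Σ cᵢ eᵢ) + Q(Σ cᵢ oᵢ)`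
  have hG : IsWeilTest (fun t : ℝ ↦ ∑ i, (c i : ℂ) * g i t) := isWeilTest_combination g htest c
  have hGreal : ∀ t : ℝ, (∑ i, (c i : ℂ) * g i t).im = 0 := fun t ↦ by
    simp [Complex.im_sum, Complex.mul_im, hreal]
  have hdec := stub_evenOddDecomposition (fun t : ℝ ↦ ∑ i, (c i : ℂ) * g i t) hG hGreal
  have eE : (fun t : ℝ ↦ ((∑ i, (c i : ℂ) * g i t) + ∑ i, (c i : ℂ) * g i (-t)) / 2) =
      fun t : ℝ ↦ ∑ i, (c i : ℂ) * e i t := by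
    funext t
    rw [← Finset.sum_add_distrib, Finset.sum_div]
    exact Finset.sum_congr rfl fun i _ ↦ by simp only [he_def]; ring
  have eO : (fun t : ℝ ↦ ((∑ i, (c i : ℂ) * g i t) - ∑ i, (c i : ℂ) * g i (-t)) / 2) =
      fun t : ℝ ↦ ∑ i, (c i : ℂ) * o i t := by
    funext t
    rw [← Finset.sum_sub_distrib, Finset.sum_div]
    exact Finset.sum_congr rfl fun i _ ↦ by simp only [ho_def]; ring
  rw [hdec, eE, eO, Complex.add_re]
  exact add_nonneg hE hO

/-- **Counted contrapositive, full real form.**  An `#ι`-dimensional family of REAL Weil tests on whose real span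
`Re Q` is negative definite forces `#ι ≤ 2·𝒬.encard` (one conjugate PAIR of negative directions per off-line
quadruple). [cite: Bombieri2000Weil, Thm 8] -/
theorem card_le_two_mul_encard_quadrant_of_negative_real_family {ι : Type*} [Fintype ι] (g : ι → ℝ → ℂ)
    (htest : ∀ i, IsWeilTest (g i)) (hreal : ∀ i (t : ℝ), (g i t).im = 0)
    (hneg : ∀ c : ι → ℝ, c ≠ 0 → (weilQuadratic (fun t : ℝ ↦ ∑ i, (c i : ℂ) * g i t)).re < 0) :
    (Fintype.card ι : ℕ∞) ≤ 2 * Set.encard 𝒬 := by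
  by_cases hfin : Set.Finite 𝒬
  · rw [hfin.encard_eq_coe_toFinset_card]
    by_contra hlt
    rw [not_le] at hlt
    have hlt' : 2 * hfin.toFinset.card < Fintype.card ι := by exact_mod_cast hlt
    obtain ⟨c, hc0, hQ⟩ := exists_combination_re_weilQuadratic_nonneg_real hfin.toFinset
      (fun ρ hρ h1 h2 ↦ hfin.mem_toFinset.2 ⟨hρ, h1, h2⟩) hlt' g htest hreal
    exact absurd (hneg c hc0) (not_lt.2 hQ)
  · rw [Set.encard_eq_top_iff.2 hfin, ENat.mul_top (by norm_num)]
    exact le_top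

end Summit.RiemannHypothesis.RiemannHypothesis.Theorems.PfPersistenceParityIndex

end
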